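import Summits.QuantumFields.BalabanUV.Beta.GAN24.CombChargeTowerStepZero

/-!
# `BalabanUV.Beta.GAN24.CombChargeTowerCrossed` — binder row G-an2-4 ∕ (CONV-C), W-slot (α-0), ROW (C) AT LEVELS `≥ 1`, the CROSSED-VALUE LEDGER of the OWNER's two-index tower
# (`PairFormPeriodTower` §3; the END probes' hypothesis `hXu`): **THE CROSSED-ORBIT ROW OF ROAD-P2's ONE-STEP LAW, AND `hXu` ⟺ ONE FORCING ∕ DRESSING IDENTITY PER LEVEL** —
# `X_N(T̃_{j+1})(a,b) = X_N(b̃_j)(a,b) + 2λ̂·X_Lc(𝔇T̃_j)(a,b)` (`X` := the crossed orbit sum `(ab;ab)+(ba;ab)+(ab;ba)+(ba;ba)` of the zero-mode charge), hence at the cell `N = Lc` (where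
# `2λ̂ = u`, the charge factor of `PairFormSourceOfMember`): «`X(T̃_{l+2}) = u·X(T̃_{l+1})` for all `l`» ⟺ «`X(b̃_{l+1}) = u·(X(T̃_{l+1}) − X(𝔇T̃_{l+1}))` for all `l`» — the member's crossed
# ratio `hXu` IS the statement that the forcing's crossed cell value equals `u` times MINUS the dressing defect's crossed value, level by level (road-P2 chair `b2b-balaban-gan24-p2`,
# gen 50; journal [GAN24P2-G50-INTENT5]; for the suppliers' VALUE ledger — leaf-04's numbers, leaf-06 K7)

NOT IN PRINT; OUR BOOKKEEPING ([folklore] one instance of `CombChargeTowerStepZero.legBondSym_zmode_succ_eq_dress` at the crossed orbit + `linarith`; 0 `def`, 0 cited fact,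
0 `def … : Prop`, 0 sorry).  HONEST FRAMING (cell contract, verbatim): «discharging `BetaPertH` makes Bałaban's UV stability UNCONDITIONAL — a real constructive-QFT result; it is NOT
the continuum limit and NOT the Clay problem.»  HONEST DEPENDENCY (verbatim): «continuum YM on T⁴ ⇐ BetaPertH ∧ nine spine estimates (0/9 proved); BetaPertH ⇐ (D1) ∧ (D4) ∧ CAP+tail;
G-an2-4 gates asym, D1 and NE2/3/4.»  Generic `d`, every `j`, every cell period `N`, ALL constants symbolic, generic border (the letters of `T2RecChargeStep.zmode_succ_eq`).
Asserts NO value of Bałaban's tables; discharges NOTHING of `hXu` ∕ (C)_{≥1}; NEVER «G-an2-4 closed» as (CONV-C); NOT D1, NOT `BetaPertH`, NOT continuum, NOT Clay.  2026-08-24.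
-/

noncomputable section

open Finset
open scoped BigOperators
open Literature.MathematicalPhysics.QuantumFieldTheory
open Literature.MathematicalPhysics.QuantumFieldTheory.Balaban1983to89
open Literature.MathematicalPhysics.QuantumFieldTheory.Balaban1983to89.Beta
open ExpKernelCalculus (MKer shiftK)
open OneStepResolventKernel (Fib)
open OneStepKernelFamily (KInvStep)
open AffineAveraging (Site box toSite)
open BalabanCompositeJets (LocStencil₂)
open SecondOrderResponse (W2SymOfK)
open BalabanStepJetsSucc (mmRead)
open BalabanStepW2 (K3OfK M2Of)
open AveragingMixedJetTables (mixFFAt)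
open Summit.QuantumFields.BalabanUV.Beta.HessKerDressedUnits (unitK unitS)
open Summit.QuantumFields.BalabanUV.Beta.SecondOrderUnits (unitM unitS₂ unitM₂)
open Summit.QuantumFields.BalabanUV.Beta.AxialDressingRooted (coProjBmAtK coDressKBmAt dressKBmAt)
open Summit.QuantumFields.BalabanUV.Beta.SpineRooted (T2RecAt SpureRecAt M1At)
open Summit.QuantumFields.BalabanUV.Beta.GAN24.CombesThomas (sfStep smStep)
open Summit.QuantumFields.BalabanUV.Beta.GAN24.BiStencilZeroMode (Tab zmode)
open Summit.QuantumFields.BalabanUV.Beta.GAN24.CombChargeTowerStepZero (legBondSym_zmode_succ_eq_dress)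

namespace Summit.QuantumFields.BalabanUV.Beta.GAN24.CombChargeTowerCrossed

variable {d : ℕ} {Lc : ℕ} [NeZero Lc] {r : Fin (d + 1) → ℕ}

/-- NOT IN PRINT; OUR BOOKKEEPING.  **THE CROSSED-ORBIT ROW OF THE ONE-STEP LAW**: `X_N(T̃_{j+1})(a,b) = X_N(b̃_j)(a,b) + 2λ̂·X_Lc(𝔇T̃_j)(a,b)` — the leg-and-bond symmetrised
row `legBondSym_zmode_succ_eq_dress` at the crossed index pattern `(κ,κ′,κ₁,κ₂) = (a,b,a,b)` (one scalar per pair, level and cell period). -/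
theorem crossed_zmode_succ_eq (hLc : 1 ≤ Lc) (hr : r ∈ box (d + 1) Lc) (cE cVH cΛ cE₂ cB : ℝ) (Tc : Fin 4 → Fin 4 → Fin 4 → Fin 4 → ℝ)
    {vh₂S : Tab d} (hBff : ∀ κ u κ' u' x z (α β : Fin (d + 1)), vh₂S κ u κ' u' x z (Sum.inl α) (Sum.inl β) = 0)
    (hBmm : ∀ κ u κ' u' x z (μ ν : Fin (d + 1)), vh₂S κ u κ' u' x z (Sum.inr μ) (Sum.inr ν) = 0)
    (hB : ∃ C δ : ℝ, 0 < δ ∧ LocStencil₂ vh₂S C δ)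
    (hBt : ∀ (κ : Fin (d + 1)) (u : Fin (d + 1) → ℤ) (κ' : Fin (d + 1)) (u' t : Fin (d + 1) → ℤ),
      vh₂S κ (u + (Lc : ℤ) • t) κ' (u' + (Lc : ℤ) • t) = shiftK (-((Lc : ℤ) • t)) (vh₂S κ u κ' u')) (N j : ℕ) (a b : Fin (d + 1)) :
    (zmode N (unitS₂ (sfStep Lc (j + 1)) (smStep d Lc (j + 1)) (T2RecAt d Lc (toSite r) cE cVH cΛ cE₂ cB Tc vh₂S (mixFFAt (toSite r) Lc) (j + 1))) a b (Sum.inl a) (Sum.inl b)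
      + zmode N (unitS₂ (sfStep Lc (j + 1)) (smStep d Lc (j + 1)) (T2RecAt d Lc (toSite r) cE cVH cΛ cE₂ cB Tc vh₂S (mixFFAt (toSite r) Lc) (j + 1))) b a (Sum.inl a) (Sum.inl b)
      + (zmode N (unitS₂ (sfStep Lc (j + 1)) (smStep d Lc (j + 1)) (T2RecAt d Lc (toSite r) cE cVH cΛ cE₂ cB Tc vh₂S (mixFFAt (toSite r) Lc) (j + 1))) a b (Sum.inl b) (Sum.inl a)
      + zmode N (unitS₂ (sfStep Lc (j + 1)) (smStep d Lc (j + 1)) (T2RecAt d Lc (toSite r) cE cVH cΛ cE₂ cB Tc vh₂S (mixFFAt (toSite r) Lc) (j + 1))) b a (Sum.inl b) (Sum.inl a)))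
      = (zmode N ((fun κ u κ' u' => (cE₂ * (Lc : ℝ) ^ (2 * (d + 1))) • mmRead Lc (K3OfK (unitK (sfStep Lc j) (smStep d Lc j) (coDressKBmAt (toSite r) Lc (KInvStep (d := d) Lc j))) Lc (unitS (sfStep Lc j) (smStep d Lc j) (SpureRecAt d Lc (toSite r) cE cVH cΛ j)) (unitM (sfStep Lc j) (smStep d Lc j) (M1At d Lc (toSite r) cΛ j)) (W2SymOfK (unitK (sfStep Lc j) (smStep d Lc j) (coDressKBmAt (toSite r) Lc (KInvStep (d := d) Lc j))) Lc (unitS (sfStep Lc j) (smStep d Lc j) (SpureRecAt d Lc (toSite r) cE cVH cΛ j)) (unitM (sfStep Lc j) (smStep d Lc j) (M1At d Lc (toSite r) cΛ j)) 0 (unitM₂ (sfStep Lc j) (smStep d Lc j) (M2Of d Lc (mixFFAt (toSite r) Lc) j))) κ u κ' u') + cB • vh₂S κ u κ' u')) a b (Sum.inl a) (Sum.inl b)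
      + zmode N ((fun κ u κ' u' => (cE₂ * (Lc : ℝ) ^ (2 * (d + 1))) • mmRead Lc (K3OfK (unitK (sfStep Lc j) (smStep d Lc j) (coDressKBmAt (toSite r) Lc (KInvStep (d := d) Lc j))) Lc (unitS (sfStep Lc j) (smStep d Lc j) (SpureRecAt d Lc (toSite r) cE cVH cΛ j)) (unitM (sfStep Lc j) (smStep d Lc j) (M1At d Lc (toSite r) cΛ j)) (W2SymOfK (unitK (sfStep Lc j) (smStep d Lc j) (coDressKBmAt (toSite r) Lc (KInvStep (d := d) Lc j))) Lc (unitS (sfStep Lc j) (smStep d Lc j) (SpureRecAt d Lc (toSite r) cE cVH cΛ j)) (unitM (sfStep Lc j) (smStep d Lc j) (M1At d Lc (toSite r) cΛ j)) 0 (unitM₂ (sfStep Lc j) (smStep d Lc j) (M2Of d Lc (mixFFAt (toSite r) Lc) j))) κ u κ' u') + cB • vh₂S κ u κ' u')) b a (Sum.inl a) (Sum.inl b)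
      + (zmode N ((fun κ u κ' u' => (cE₂ * (Lc : ℝ) ^ (2 * (d + 1))) • mmRead Lc (K3OfK (unitK (sfStep Lc j) (smStep d Lc j) (coDressKBmAt (toSite r) Lc (KInvStep (d := d) Lc j))) Lc (unitS (sfStep Lc j) (smStep d Lc j) (SpureRecAt d Lc (toSite r) cE cVH cΛ j)) (unitM (sfStep Lc j) (smStep d Lc j) (M1At d Lc (toSite r) cΛ j)) (W2SymOfK (unitK (sfStep Lc j) (smStep d Lc j) (coDressKBmAt (toSite r) Lc (KInvStep (d := d) Lc j))) Lc (unitS (sfStep Lc j) (smStep d Lc j) (SpureRecAt d Lc (toSite r) cE cVH cΛ j)) (unitM (sfStep Lc j) (smStep d Lc j) (M1At d Lc (toSite r) cΛ j)) 0 (unitM₂ (sfStep Lc j) (smStep d Lc j) (M2Of d Lc (mixFFAt (toSite r) Lc) j))) κ u κ' u') + cB • vh₂S κ u κ' u')) a b (Sum.inl b) (Sum.inl a)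
      + zmode N ((fun κ u κ' u' => (cE₂ * (Lc : ℝ) ^ (2 * (d + 1))) • mmRead Lc (K3OfK (unitK (sfStep Lc j) (smStep d Lc j) (coDressKBmAt (toSite r) Lc (KInvStep (d := d) Lc j))) Lc (unitS (sfStep Lc j) (smStep d Lc j) (SpureRecAt d Lc (toSite r) cE cVH cΛ j)) (unitM (sfStep Lc j) (smStep d Lc j) (M1At d Lc (toSite r) cΛ j)) (W2SymOfK (unitK (sfStep Lc j) (smStep d Lc j) (coDressKBmAt (toSite r) Lc (KInvStep (d := d) Lc j))) Lc (unitS (sfStep Lc j) (smStep d Lc j) (SpureRecAt d Lc (toSite r) cE cVH cΛ j)) (unitM (sfStep Lc j) (smStep d Lc j) (M1At d Lc (toSite r) cΛ j)) 0 (unitM₂ (sfStep Lc j) (smStep d Lc j) (M2Of d Lc (mixFFAt (toSite r) Lc) j))) κ u κ' u') + cB • vh₂S κ u κ' u')) b a (Sum.inl b) (Sum.inl a)))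
        + (2 * (((N : ℝ) ^ (d + 1)) * ((cE₂ * (Lc : ℝ) ^ (2 * (d + 1))) * ((1 / 2 : ℝ) * (((Lc : ℝ) ^ (d + 1 + 1))⁻¹) ^ 4)))) *
          (zmode Lc ((fun κ u κ' u' => dressKBmAt (toSite r) Lc (coProjBmAtK (toSite r) Lc (fun κ₁ u₁ => coProjBmAtK (toSite r) Lc (unitS₂ (sfStep Lc j) (smStep d Lc j) (T2RecAt d Lc (toSite r) cE cVH cΛ cE₂ cB Tc vh₂S (mixFFAt (toSite r) Lc) j) κ₁ u₁) κ' u') κ u))) a b (Sum.inl a) (Sum.inl b)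
      + zmode Lc ((fun κ u κ' u' => dressKBmAt (toSite r) Lc (coProjBmAtK (toSite r) Lc (fun κ₁ u₁ => coProjBmAtK (toSite r) Lc (unitS₂ (sfStep Lc j) (smStep d Lc j) (T2RecAt d Lc (toSite r) cE cVH cΛ cE₂ cB Tc vh₂S (mixFFAt (toSite r) Lc) j) κ₁ u₁) κ' u') κ u))) b a (Sum.inl a) (Sum.inl b)
      + (zmode Lc ((fun κ u κ' u' => dressKBmAt (toSite r) Lc (coProjBmAtK (toSite r) Lc (fun κ₁ u₁ => coProjBmAtK (toSite r) Lc (unitS₂ (sfStep Lc j) (smStep d Lc j) (T2RecAt d Lc (toSite r) cE cVH cΛ cE₂ cB Tc vh₂S (mixFFAt (toSite r) Lc) j) κ₁ u₁) κ' u') κ u))) a b (Sum.inl b) (Sum.inl a)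
      + zmode Lc ((fun κ u κ' u' => dressKBmAt (toSite r) Lc (coProjBmAtK (toSite r) Lc (fun κ₁ u₁ => coProjBmAtK (toSite r) Lc (unitS₂ (sfStep Lc j) (smStep d Lc j) (T2RecAt d Lc (toSite r) cE cVH cΛ cE₂ cB Tc vh₂S (mixFFAt (toSite r) Lc) j) κ₁ u₁) κ' u') κ u))) b a (Sum.inl b) (Sum.inl a))) :=
  legBondSym_zmode_succ_eq_dress hLc hr cE cVH cΛ cE₂ cB Tc hBff hBmm hB hBt N j a b a b

/-- NOT IN PRINT; OUR BOOKKEEPING.  **THE OWNER's MEMBER CROSSED RATIO `hXu` IS ONE FORCING ∕ DRESSING IDENTITY PER LEVEL**: at the cell `N = Lc` the coefficient `2λ̂` IS the charge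
factor `u = Lc^{d+1}·cE₂·Lc^{2(d+1)}·(Lc^{d+2})⁻⁴` of `PairFormSourceOfMember`, so «`X(T̃_{l+2}) = u·X(T̃_{l+1})` for every `l`, `a ≠ b`» ⟺ «`X(b̃_{l+1}) + u·X(𝔇T̃_{l+1}) = u·X(T̃_{l+1})`
for every `l`, `a ≠ b`» — what the suppliers' VALUE ledger must deliver is the forcing's crossed cell value against the dressing defect's, level by level. -/
theorem memberCrossedRatio_iff_forcingCrossed (hLc : 1 ≤ Lc) (hr : r ∈ box (d + 1) Lc) (cE cVH cΛ cE₂ cB : ℝ) (Tc : Fin 4 → Fin 4 → Fin 4 → Fin 4 → ℝ)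
    {vh₂S : Tab d} (hBff : ∀ κ u κ' u' x z (α β : Fin (d + 1)), vh₂S κ u κ' u' x z (Sum.inl α) (Sum.inl β) = 0)
    (hBmm : ∀ κ u κ' u' x z (μ ν : Fin (d + 1)), vh₂S κ u κ' u' x z (Sum.inr μ) (Sum.inr ν) = 0)
    (hB : ∃ C δ : ℝ, 0 < δ ∧ LocStencil₂ vh₂S C δ)
    (hBt : ∀ (κ : Fin (d + 1)) (u : Fin (d + 1) → ℤ) (κ' : Fin (d + 1)) (u' t : Fin (d + 1) → ℤ),
      vh₂S κ (u + (Lc : ℤ) • t) κ' (u' + (Lc : ℤ) • t) = shiftK (-((Lc : ℤ) • t)) (vh₂S κ u κ' u')) :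
    (∀ (l : ℕ) (a b : Fin (d + 1)), a ≠ b →
      (zmode Lc (unitS₂ (sfStep Lc (l + 1 + 1)) (smStep d Lc (l + 1 + 1)) (T2RecAt d Lc (toSite r) cE cVH cΛ cE₂ cB Tc vh₂S (mixFFAt (toSite r) Lc) (l + 1 + 1))) a b (Sum.inl a) (Sum.inl b)
      + zmode Lc (unitS₂ (sfStep Lc (l + 1 + 1)) (smStep d Lc (l + 1 + 1)) (T2RecAt d Lc (toSite r) cE cVH cΛ cE₂ cB Tc vh₂S (mixFFAt (toSite r) Lc) (l + 1 + 1))) b a (Sum.inl a) (Sum.inl b)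
      + (zmode Lc (unitS₂ (sfStep Lc (l + 1 + 1)) (smStep d Lc (l + 1 + 1)) (T2RecAt d Lc (toSite r) cE cVH cΛ cE₂ cB Tc vh₂S (mixFFAt (toSite r) Lc) (l + 1 + 1))) a b (Sum.inl b) (Sum.inl a)
      + zmode Lc (unitS₂ (sfStep Lc (l + 1 + 1)) (smStep d Lc (l + 1 + 1)) (T2RecAt d Lc (toSite r) cE cVH cΛ cE₂ cB Tc vh₂S (mixFFAt (toSite r) Lc) (l + 1 + 1))) b a (Sum.inl b) (Sum.inl a)))
        = (((Lc : ℝ) ^ (d + 1)) * ((cE₂ * (Lc : ℝ) ^ (2 * (d + 1))) * (((Lc : ℝ) ^ (d + 1 + 1))⁻¹) ^ 4)) *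
          (zmode Lc (unitS₂ (sfStep Lc (l + 1)) (smStep d Lc (l + 1)) (T2RecAt d Lc (toSite r) cE cVH cΛ cE₂ cB Tc vh₂S (mixFFAt (toSite r) Lc) (l + 1))) a b (Sum.inl a) (Sum.inl b)
      + zmode Lc (unitS₂ (sfStep Lc (l + 1)) (smStep d Lc (l + 1)) (T2RecAt d Lc (toSite r) cE cVH cΛ cE₂ cB Tc vh₂S (mixFFAt (toSite r) Lc) (l + 1))) b a (Sum.inl a) (Sum.inl b)
      + (zmode Lc (unitS₂ (sfStep Lc (l + 1)) (smStep d Lc (l + 1)) (T2RecAt d Lc (toSite r) cE cVH cΛ cE₂ cB Tc vh₂S (mixFFAt (toSite r) Lc) (l + 1))) a b (Sum.inl b) (Sum.inl a)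
      + zmode Lc (unitS₂ (sfStep Lc (l + 1)) (smStep d Lc (l + 1)) (T2RecAt d Lc (toSite r) cE cVH cΛ cE₂ cB Tc vh₂S (mixFFAt (toSite r) Lc) (l + 1))) b a (Sum.inl b) (Sum.inl a))))
    ↔ (∀ (l : ℕ) (a b : Fin (d + 1)), a ≠ b →
      (zmode Lc ((fun κ u κ' u' => (cE₂ * (Lc : ℝ) ^ (2 * (d + 1))) • mmRead Lc (K3OfK (unitK (sfStep Lc (l + 1)) (smStep d Lc (l + 1)) (coDressKBmAt (toSite r) Lc (KInvStep (d := d) Lc (l + 1)))) Lc (unitS (sfStep Lc (l + 1)) (smStep d Lc (l + 1)) (SpureRecAt d Lc (toSite r) cE cVH cΛ (l + 1))) (unitM (sfStep Lc (l + 1)) (smStep d Lc (l + 1)) (M1At d Lc (toSite r) cΛ (l + 1))) (W2SymOfK (unitK (sfStep Lc (l + 1)) (smStep d Lc (l + 1)) (coDressKBmAt (toSite r) Lc (KInvStep (d := d) Lc (l + 1)))) Lc (unitS (sfStep Lc (l + 1)) (smStep d Lc (l + 1)) (SpureRecAt d Lc (toSite r) cE cVH cΛ (l + 1))) (unitM (sfStep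 Lc (l + 1)) (smStep d Lc (l + 1)) (M1At d Lc (toSite r) cΛ (l + 1))) 0 (unitM₂ (sfStep Lc (l + 1)) (smStep d Lc (l + 1)) (M2Of d Lc (mixFFAt (toSite r) Lc) (l + 1)))) κ u κ' u') + cB • vh₂S κ u κ' u')) a b (Sum.inl a) (Sum.inl b)
      + zmode Lc ((fun κ u κ' u' => (cE₂ * (Lc : ℝ) ^ (2 * (d + 1))) • mmRead Lc (K3OfK (unitK (sfStep Lc (l + 1)) (smStep d Lc (l + 1)) (coDressKBmAt (toSite r) Lc (KInvStep (d := d) Lc (l + 1)))) Lc (unitS (sfStep Lc (l + 1)) (smStep d Lc (l + 1)) (SpureRecAt d Lc (toSite r) cE cVH cΛ (l + 1))) (unitM (sfStep Lc (l + 1)) (smStep d Lc (l + 1)) (M1At d Lc (toSite r) cΛ (l + 1))) (W2SymOfK (unitK (sfStep Lc (l + 1)) (smStep d Lc (l + 1)) (coDressKBmAt (toSite r) Lc (KInvStep (d := d) Lc (l + 1)))) Lc (unitS (sfStep Lc (l + 1)) (smStep d Lc (l + 1)) (SpureRecAt d Lc (toSite r) cE cVH cΛ (l + 1))) (unitM (sfStep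 Lc (l + 1)) (smStep d Lc (l + 1)) (M1At d Lc (toSite r) cΛ (l + 1))) 0 (unitM₂ (sfStep Lc (l + 1)) (smStep d Lc (l + 1)) (M2Of d Lc (mixFFAt (toSite r) Lc) (l + 1)))) κ u κ' u') + cB • vh₂S κ u κ' u')) b a (Sum.inl a) (Sum.inl b)
      + (zmode Lc ((fun κ u κ' u' => (cE₂ * (Lc : ℝ) ^ (2 * (d + 1))) • mmRead Lc (K3OfK (unitK (sfStep Lc (l + 1)) (smStep d Lc (l + 1)) (coDressKBmAt (toSite r) Lc (KInvStep (d := d) Lc (l + 1)))) Lc (unitS (sfStep Lc (l + 1)) (smStep d Lc (l + 1)) (SpureRecAt d Lc (toSite r) cE cVH cΛ (l + 1))) (unitM (sfStep Lc (l + 1)) (smStep d Lc (l + 1)) (M1At d Lc (toSite r) cΛ (l + 1))) (W2SymOfK (unitK (sfStep Lc (l + 1)) (smStep d Lc (l + 1)) (coDressKBmAt (toSite r) Lc (KInvStep (d := d) Lc (l + 1)))) Lc (unitS (sfStep Lc (l + 1)) (smStep d Lc (l + 1)) (SpureRecAt d Lc (toSite r) cE cVH cΛ (l + 1))) (unitM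 (sfStep Lc (l + 1)) (smStep d Lc (l + 1)) (M1At d Lc (toSite r) cΛ (l + 1))) 0 (unitM₂ (sfStep Lc (l + 1)) (smStep d Lc (l + 1)) (M2Of d Lc (mixFFAt (toSite r) Lc) (l + 1)))) κ u κ' u') + cB • vh₂S κ u κ' u')) a b (Sum.inl b) (Sum.inl a)
      + zmode Lc ((fun κ u κ' u' => (cE₂ * (Lc : ℝ) ^ (2 * (d + 1))) • mmRead Lc (K3OfK (unitK (sfStep Lc (l + 1)) (smStep d Lc (l + 1)) (coDressKBmAt (toSite r) Lc (KInvStep (d := d) Lc (l + 1)))) Lc (unitS (sfStep Lc (l + 1)) (smStep d Lc (l + 1)) (SpureRecAt d Lc (toSite r) cE cVH cΛ (l + 1))) (unitM (sfStep Lc (l + 1)) (smStep d Lc (l + 1)) (M1At d Lc (toSite r) cΛ (l + 1))) (W2SymOfK (unitK (sfStep Lc (l + 1)) (smStep d Lc (l + 1)) (coDressKBmAt (toSite r) Lc (KInvStep (d := d) Lc (l + 1)))) Lc (unitS (sfStep Lc (l + 1)) (smStep d Lc (l + 1)) (SpureRecAt d Lc (toSite r) cE cVH cΛ (l + 1)))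 (unitM (sfStep Lc (l + 1)) (smStep d Lc (l + 1)) (M1At d Lc (toSite r) cΛ (l + 1))) 0 (unitM₂ (sfStep Lc (l + 1)) (smStep d Lc (l + 1)) (M2Of d Lc (mixFFAt (toSite r) Lc) (l + 1)))) κ u κ' u') + cB • vh₂S κ u κ' u')) b a (Sum.inl b) (Sum.inl a)))
        + (((Lc : ℝ) ^ (d + 1)) * ((cE₂ * (Lc : ℝ) ^ (2 * (d + 1))) * (((Lc : ℝ) ^ (d + 1 + 1))⁻¹) ^ 4)) *
          (zmode Lc ((fun κ u κ' u' => dressKBmAt (toSite r) Lc (coProjBmAtK (toSite r) Lc (fun κ₁ u₁ => coProjBmAtK (toSite r) Lc (unitS₂ (sfStep Lc (l + 1)) (smStep d Lc (l + 1)) (T2RecAt d Lc (toSite r) cE cVH cΛ cE₂ cB Tc vh₂S (mixFFAt (toSite r) Lc) (l + 1)) κ₁ u₁) κ' u') κ u))) a b (Sum.inl a) (Sum.inl b)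
      + zmode Lc ((fun κ u κ' u' => dressKBmAt (toSite r) Lc (coProjBmAtK (toSite r) Lc (fun κ₁ u₁ => coProjBmAtK (toSite r) Lc (unitS₂ (sfStep Lc (l + 1)) (smStep d Lc (l + 1)) (T2RecAt d Lc (toSite r) cE cVH cΛ cE₂ cB Tc vh₂S (mixFFAt (toSite r) Lc) (l + 1)) κ₁ u₁) κ' u') κ u))) b a (Sum.inl a) (Sum.inl b)
      + (zmode Lc ((fun κ u κ' u' => dressKBmAt (toSite r) Lc (coProjBmAtK (toSite r) Lc (fun κ₁ u₁ => coProjBmAtK (toSite r) Lc (unitS₂ (sfStep Lc (l + 1)) (smStep d Lc (l + 1)) (T2RecAt d Lc (toSite r) cE cVH cΛ cE₂ cB Tc vh₂S (mixFFAt (toSite r) Lc) (l + 1)) κ₁ u₁) κ' u') κ u))) a b (Sum.inl b) (Sum.inl a)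
      + zmode Lc ((fun κ u κ' u' => dressKBmAt (toSite r) Lc (coProjBmAtK (toSite r) Lc (fun κ₁ u₁ => coProjBmAtK (toSite r) Lc (unitS₂ (sfStep Lc (l + 1)) (smStep d Lc (l + 1)) (T2RecAt d Lc (toSite r) cE cVH cΛ cE₂ cB Tc vh₂S (mixFFAt (toSite r) Lc) (l + 1)) κ₁ u₁) κ' u') κ u))) b a (Sum.inl b) (Sum.inl a)))
        = (((Lc : ℝ) ^ (d + 1)) * ((cE₂ * (Lc : ℝ) ^ (2 * (d + 1))) * (((Lc : ℝ) ^ (d + 1 + 1))⁻¹) ^ 4)) *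
          (zmode Lc (unitS₂ (sfStep Lc (l + 1)) (smStep d Lc (l + 1)) (T2RecAt d Lc (toSite r) cE cVH cΛ cE₂ cB Tc vh₂S (mixFFAt (toSite r) Lc) (l + 1))) a b (Sum.inl a) (Sum.inl b)
      + zmode Lc (unitS₂ (sfStep Lc (l + 1)) (smStep d Lc (l + 1)) (T2RecAt d Lc (toSite r) cE cVH cΛ cE₂ cB Tc vh₂S (mixFFAt (toSite r) Lc) (l + 1))) b a (Sum.inl a) (Sum.inl b)
      + (zmode Lc (unitS₂ (sfStep Lc (l + 1)) (smStep d Lc (l + 1)) (T2RecAt d Lc (toSite r) cE cVH cΛ cE₂ cB Tc vh₂S (mixFFAt (toSite r) Lc) (l + 1))) a b (Sum.inl b) (Sum.inl a)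
      + zmode Lc (unitS₂ (sfStep Lc (l + 1)) (smStep d Lc (l + 1)) (T2RecAt d Lc (toSite r) cE cVH cΛ cE₂ cB Tc vh₂S (mixFFAt (toSite r) Lc) (l + 1))) b a (Sum.inl b) (Sum.inl a)))) := by
  have hcoef : (2 : ℝ) * (((Lc : ℝ) ^ (d + 1)) * ((cE₂ * (Lc : ℝ) ^ (2 * (d + 1))) * ((1 / 2 : ℝ) * (((Lc : ℝ) ^ (d + 1 + 1))⁻¹) ^ 4))) = (((Lc : ℝ) ^ (d + 1)) * ((cE₂ * (Lc : ℝ) ^ (2 * (d + 1))) * (((Lc : ℝ) ^ (d + 1 + 1))⁻¹) ^ 4)) := by ring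
  constructor
  · intro h l a b hab
    have e := crossed_zmode_succ_eq hLc hr cE cVH cΛ cE₂ cB Tc hBff hBmm hB hBt Lc (l + 1) a b
    rw [hcoef] at e
    have h1 := h l a b hab
    linarith
  · intro h l a b hab
    have e := crossed_zmode_succ_eq hLc hr cE cVH cΛ cE₂ cB Tc hBff hBmm hB hBt Lc (l + 1) a b
    rw [hcoef] at e
    have h1 := h l a b hab
    linarith

end Summit.QuantumFields.BalabanUV.Beta.GAN24.CombChargeTowerCrossed

end
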